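import Summits.CriticalPhenomena.CardyFormulaZ2.Theorems.CardyComplexConeParafermionToSLESixFamiliesDiamondDefs
import Summits.CriticalPhenomena.CardyFormulaZ2.Theorems.CardyComplexConeParafermionToSLESixFamiliesDiamondArgumentPrinciple
import Summits.CriticalPhenomena.CardyFormulaZ2.Theorems.CardyComplexConeParafermionToSLESixFamiliesDiamondExactPair
import Summits.CriticalPhenomena.CardyFormulaZ2.Theorems.CardyComplexConeParafermionToSLESixFamiliesDiamondVertexRelationArcA
import Summits.CriticalPhenomena.CardyFormulaZ2.Theorems.CardyComplexConeParafermionToSLESixFamiliesDiamondDefsR4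
import Summits.CriticalPhenomena.CardyFormulaZ2.Theorems.CardyComplexConeParafermionToSLESixFamiliesDiamondIdentifyPotentialPh
import Summits.CriticalPhenomena.CardyFormulaZ2.Theorems.CardyComplexConeParafermionToSLESixFamiliesDiamondBoundaryDartPhase
import Summits.CriticalPhenomena.CardyFormulaZ2.Theorems.CardyComplexConeParafermionToSLESixFamiliesDiamondArcsConnected
import Summits.CriticalPhenomena.CardyFormulaZ2.Theorems.CardyComplexConeParafermionToSLESixFamiliesDiamondExactPotentialTracePh3
import Summits.CriticalPhenomena.CardyFormulaZ2.Theorems.CardyComplexConeParafermionToSLESixFamiliesDiamondDefsR6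
import Summits.CriticalPhenomena.CardyFormulaZ2.Theorems.CardyComplexConeParafermionToSLESixFamiliesIicRectilinear
import Summits.CriticalPhenomena.CardyFormulaZ2.Theorems.CardyComplexConeParafermionToSLESixFamiliesFlipAllDomainsOfDiag
import HarnessLib.Audit

/-!
# Skeleton of line `potential-darboux-picard-diamond` — crux `ParafermionToSLESixFamilies`
(stmt-CriticalPhenomena-11389, route `CardyComplexCone`, sub-problem `CriticalPhenomena/CardyFormulaZ2`)

Lead c5 (`prover-line-stmt-CriticalPhenomena-11389-c5-0`), revision r6 (after wave 5) of the planner's checked skeleton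
(`planner-cruxplan-stmt-CriticalPhenomena-11389-potential-darboux-pi-0`, tree `Lines/potential_darboux_picard_diamond.lean` r0,
commit 3e3ea80ec0fb; idea card `Ideas/potential-darboux-picard-diamond.md`, line card `Lines/potential-darboux-picard-diamond.md`;
triage r2-1 PASS, r2-2 PASS).

r1 RESHAPE (vocabulary only; the seven registered stub signatures and the composition are byte-identical to r0):
* §1–§2 (vocabulary + typed statements) now live, sorry-free, in the LANDED definitions module
  `Theorems/CardyComplexConeParafermionToSLESixFamiliesDiamondDefs.lean` (p137545), imported above;
* the all-diagonal geometry `IsDiagDir / IsDiagFreeWindow / IsDiagRectilinear / IdentOnDiagRectilinear` is the landed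
  `…FlipDefs` copy (namespace `…FlipInvolutionReturnLaw`), so that S7 `stub_allDomainsOfDiagRectilinear` is VERBATIM line
  flip's `stub_allDomainsOfDiag` (its landed reduction `FlipInvolutionReturnLaw.allDomainsOfDiag_of`, PIECE 2 proved, p134764,
  is imported above and applies by name) and S6 is the pinned twin of flip's `stub_identDiag`.


r6 RESHAPE (after wave 5, 2026-08-17T16:00Z): wave 5 landed the CONDITIONAL derivations of the three conjuncts of S3 from inputs external to the crux —
`collar_of_uniformInnerEnvelope : UniformInnerEnvelope → ClosedCollar` (p165486), `freeTouchLower_of_diagArmLower : DiagHalfPlaneOneArmLower → FreeTouchLower`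
(p168828), `closedClass_continuous_of_edgeCoherence` (p165722: the class conjunct from `EdgeCoherence` ALONE, in CONTINUITY-GUARDED form; the unguarded
(b′) of the planner's `ClosedPrecompactness` is too strong as typed — `not_isPotentialLimit_of_closedClass`). Hence S3 ↦ S3′ `stub_closedPrecompactnessC :
ClosedPrecompactnessC` (`…DiamondDefsR6.lean`, p168985: the guarded statement; `closedPrecompactnessC_of_inputs : UniformInnerEnvelope → EdgeCoherence →
DiagHalfPlaneOneArmLower → ClosedPrecompactnessC`; the assembly re-run `potentialConformalLimit_of_identifyC`, `identifyPotentialPhC`; and the line's HEADLINE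
`potentialConformalLimit_of_inputs : UniformInnerEnvelope → EdgeCoherence → DiagHalfPlaneOneArmLower → PotentialConformalLimit`, `…_of_ikhlefPonsaing`).
Open: S3′ (⇐ X1 + stmt-11385 + N ⇐ IkhlefPonsaingFirstPassage, kernel-checked), S5 (U), S6, S7. Four registered stubs.

r5 (after wave 4, 2026-08-17T13:35Z): S1p `stub_boundaryDartPhase` LANDED p162076, S1c `stub_diamondArcsConnected` LANDED p157908, S1‴
`stub_exactPotentialTracePh3` LANDED p158589 — the whole lattice side S1 (exact potential + phase-anchored boundary trace) is CLOSED, as are S2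
(p139330) and the engine S4′ (p153682). The line's theorem so far: `ExactPotentialTracePh` (S1), `DarbouxPicardConvex ∧ TraceWindingNonneg` (S2),
`ClosedPrecompactness → PotentialConformalLimit` (S4′ ∘ S1 ∘ S2: N + I on marked diamonds GIVEN the collar/class/non-degeneracy inputs of S3).
Open: S3 `stub_closedPrecompactness` (⇐ IkhlefPonsaingFirstPassage + UniformInnerEnvelope + stmt-11385 + stmt-11387), S5 `stub_pinUniformity` (U),
S6 `stub_identOnDiagRectilinear` (⇐ PercFaceBoxTight + density transport + boundary κ = 6 detector + SLE₆ reversibility), S7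
`stub_allDomainsOfDiagRectilinear` (⇐ PIECE 1 + PIECE 3). Four registered stubs.

r4 RESHAPE (after wave 3, 2026-08-17T10:30Z):
* S4v `stub_boundaryIdentification` is CLOSED — LANDED p151443 (`…DiamondBoundaryIdentification.lean`, with p148562 BIdChain, p149063 BIdGerm,
  p149066 BIdGeometry, p149212 BIdSector, p149770 BIdLocal, p151223 BIdLocalH); hence THE ENGINE S4′ `stub_identifyPotentialPh :
  ExactPotentialTracePh → (DarbouxPicardConvex ∧ TraceWindingNonneg) → ClosedPrecompactness → PotentialConformalLimit` is CLOSED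
  (`…DiamondIdentifyPotentialPh.lean`, p153682), imported and used by name;
* S1t `stub_freeSideTurnCount` is CLOSED — LANDED p153275 (outside escape staircase; + p148386, p150638 Literature, p150717 p152164 p151323 p152550
  p151307 p151962 p151324 p151322 p151980 p151963 helpers) — but the S1″ assembly worker showed `FreeSideTurnCount` as typed (`∃ j`) too weak
  for (DIR): the passage phases of ALL sides, free and wired, must be tied to ONE anchor through `diamondTau`; hence S1″ is replaced by
  S1p `stub_boundaryDartPhase : BoundaryDartPhase` + S1c `stub_diamondArcsConnected : DiamondArcsConnected` + S1‴ `stub_exactPotentialTracePh3 :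
  BoundaryDartPhase → DiamondArcsConnected → ExactPotentialTracePh` (`…DiamondDefsR4.lean`, p153793; S1″ pieces landed: p147699 TraceChain,
  p147705 TraceLayers, p147779 TraceSideLayers, p147706 TraceTouchFKG, p147789 TraceWiredChain);
* S3, S5, S6, S7 unchanged (blocked on external inputs). Seven registered stubs.

r3 RESHAPE (after wave 2, 2026-08-17T07:10Z):
* S1v `stub_vertexRelationArcA : VertexRelationArcA` is CLOSED — LANDED p142298 (`…DiamondVertexRelationArcA.lean`, with p140932 OnceTwice,
  p141001 SpliceLoop), imported and used by name;
* S4′ is reduced to S4v `stub_boundaryIdentification : BoundaryIdentification` (pure complex analysis; `…DiamondDefsR3.lean`) by the landed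
  assembly `potentialConformalLimit_of_identify` (p144695; with p140913 Hull, p141226 Ray, p141633 Tilted, p142889 Mesh, p142948 SideCells,
  p142949 Limit, p144647 Trace, p143902 LoopEdges, p144237 Loop, p144050 Enum, p144110 Pieces, p144502 Chain, p144270 Polygon, p144322 Reparam,
  p144422 Args, p144520 Conformal) — glue `identifyPotentialPh_of_boundaryIdentification` (registered, DefsR3);
* S1′ is reduced to S1t `stub_freeSideTurnCount : FreeSideTurnCount` (configuration-independent turn count at the touch darts of a straight
  free side; `…DiamondDefsR3.lean`) + S1″ `stub_exactPotentialTracePh2 : FreeSideTurnCount → ExactPotentialTracePh` (assembly of the landed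
  pieces: TURN/τ p141983 p142863 p144600, block p143145, phase p145221, bulk arcs p144656, start corner p144613, Literature winding toolkit
  p141266 p143201 p143549 p144598 p145204 p145413, wired A-chain via the theorem `stub_vertexRelationArcA`);
* S3, S5, S6, S7 unchanged (blocked on external inputs, see r2 note). Seven registered stubs.

r2 RESHAPE (after wave 1, 2026-08-17T03:50Z):
* S2 `stub_argumentPrinciple : DarbouxPicardConvex ∧ TraceWindingNonneg` is CLOSED — LANDED p139330
  (`…DiamondArgumentPrinciple.lean`, over `Literature.Analysis.Complex.DarbouxPicard` p138734), imported and used by name;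
* S1 is replaced by S1v `stub_vertexRelationArcA : VertexRelationArcA` (vertex relation at fair-coin edges with one endpoint on
  the wired arc; exact-enumeration-true, unproved) and S1′ `stub_exactPotentialTracePh : VertexRelationArcA → ExactPotentialTracePh`
  (phase-anchored DIR/LOW — wave 1 showed the un-anchored DIR/LOW false as typed: the start-dart parity flips along families;
  (E) is LANDED p138726 `exists_isExactPair` / `eventually_exists_isExactPair`);
* S4 becomes S4′ `stub_identifyPotentialPh : ExactPotentialTracePh → (DarbouxPicardConvex ∧ TraceWindingNonneg) → ClosedPrecompactness →
  PotentialConformalLimit` (the complex amplitude absorbs the anchor along a subsequence); nine S4 helper files are landed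
  (IdentifyDilation p138807, IdentifyArgument p139217, IdentifySupport p139446, IdentifyArzela p139738, IdentifyCollinear p139801,
  IdentifyExactPairs p139925, IdentifyTouchMass p139999, IdentifyReflection p140174, IdentifyBoundaryArg p140399);
* S3 (helpers p139124, p139371; blocked on IkhlefPonsaingFirstPassage + UniformInnerEnvelope + stmt-11385 + stmt-11387), S5, S6 (reduction
  p138957 `identOnDiagRectilinear_of_boxTight_of_paraApprox`; blocked on PercFaceBoxTight + density transport + κ=6 boundary detector +
  SLE₆ reversibility for counter-clockwise domains), S7 unchanged. Seven registered stubs, `stub_argumentPrinciple` no longer among them.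

The crux is `A → B → C` (`crux_iff`, over the landed blocks of `…IicDefs`). The line creates N, I, U itself (Disproof.lean §4–§5)
and does not consume A, B:

* S1 (r0/r1) `stub_exactPotentialTrace` (L) — REPLACED in r2 by S1v + S1′, see above — exact lattice potential of the closed spin-`1/3` corner form (class weights `1, i, −1, −i`
  read off `cornerObs_vertexRelation`, `χ = i`) along diamond families (E), and the robust structure of its boundary trace (DIR,
  TURN, LOW).  (E) is provable now: `Literature.Probability.LatticeModels.exists_potential_of_holeFree` (discrete Poincaré lemma)
  + `holeFree_innerFaces` + the vertex relation, after extending the form across arc-site corners (arc sites are corners of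
  non-inner faces, so the inner faces around an arc site form paths and the extension is unobstructed).
* S2 `stub_argumentPrinciple` (M) — CLOSED p139330 — `DarbouxPicardConvex ∧ TraceWindingNonneg` (argument principle on shrinking
  circles: `Literature.Topology.PlaneTopology.WindingNumber.wind`, `…LoopIndex`, `…ArgumentPrincipleWinding`).
* S3 `stub_closedPrecompactness` (research; inputs EXTERNAL to #5: `IkhlefPonsaingFirstPassage`, 11387's `UniformInnerEnvelope`,
  items 11385/11387) — collar equicontinuity (a), class structure of limits (b′), one non-degenerate free segment (c) = N.
* S4 (r0/r1) `stub_identifyPotential` — now S4′ `stub_identifyPotentialPh` — S1 → S2 → S3 → `PotentialConformalLimit` (N + I on diamonds).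
* S5 `stub_pinUniformity` (research, U — held by the lead) — `PotentialConformalLimit →` slit-uniform pinned diagonal touch law.
* S6 `stub_identOnDiagRectilinear` (XL transport) — pinned law ⇒ identification on all-diagonal polygons.
* S7 `stub_allDomainsOfDiagRectilinear` (XL transport) — = flip's `stub_allDomainsOfDiag`.

`slesixAllFamilies_of_stubs : S1 → S2 → S3 → (S4) → (S5) → (S6) → (S7) → (A → B → C)` is the sorry-free composition and
`ParafermionToSLESixFamilies_of : ParafermionToSLESixFamilies` the skeleton theorem applying the seven stubs (its `sorryAx`
dependence sits entirely in the `stub_*` declarations). `lean check`: rc 0, 7 sorries.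
-/

noncomputable section

namespace Summit.CriticalPhenomena.CardyFormulaZ2.Cruxes.ParafermionToSLESixFamilies.PotentialDarbouxPicardDiamond

open scoped Topology NNReal ENNReal BigOperators
open Filter MeasureTheory Set Metric Complex
open UpperHalfPlane (upperHalfPlaneSet)
open Literature.Probability Literature.Probability.LatticeModels Literature.Probability.Percolation
open Literature.Probability.LatticeModels.DiscreteDobrushin
open Literature.Probability.RandomPlanarGeometry
open Summit.CriticalPhenomena.CardyFormulaZ2.Theses.CardyComplexCone (ParafermionToSLESixFamilies)
open Summit.CriticalPhenomena.CardyFormulaZ2.Cruxes.ParafermionToSLESixFamilies.IicTraceFluxPairing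
open Summit.CriticalPhenomena.CardyFormulaZ2.Cruxes.ParafermionToSLESixFamilies.FlipInvolutionReturnLaw
  (IsDiagDir IsDiagFreeWindow IsDiagRectilinear IdentOnDiagRectilinear allDomainsOfDiag_of)

/-! ## §0 The crux is literally `A → B → C` -/

/-- The route declaration unfolds, definitionally, to `WeakHolFamilies → PrecompactFamilies → SLESixAllFamilies`
(the three blocks of `…IicDefs`, verbatim the crux's). -/
theorem crux_iff : ParafermionToSLESixFamilies ↔ (WeakHolFamilies → PrecompactFamilies → SLESixAllFamilies) :=
  Iff.rfl

/-! ## §1–§2 Vocabulary and typed statements: `…DiamondDefs.lean` (landed, p137545) — imported, nothing re-declared here. -/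

/-! ## §3 The registered stubs (the only `sorry`s of the file) -/

/-! **S1v — LANDED**: `stub_vertexRelationArcA : VertexRelationArcA` is the theorem of `…DiamondVertexRelationArcA.lean` (p142298),
imported above (the tree's once/twice corner-orbit analysis re-run at fair-coin edges with one endpoint on the wired arc). -/

/-! **S1t — LANDED** (`stub_freeSideTurnCount`, p153275) — superseded as an input by S1p below (the `∃ j` form is too weak). -/

/-! **S1 — CLOSED (r5).** S1p `stub_boundaryDartPhase : BoundaryDartPhase` (p162076), S1c `stub_diamondArcsConnected : DiamondArcsConnected`
(p157908) and S1‴ `stub_exactPotentialTracePh3 : BoundaryDartPhase → DiamondArcsConnected → ExactPotentialTracePh` (p158589) are LANDED and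
imported; `exactPotentialTracePh_holds` below is their composition. -/

/-- **S1 (the lattice side of the line), proved**: the exact potential and its phase-anchored boundary trace along every admissible
family of every marked diamond. -/
example : ExactPotentialTracePh := exactPotentialTracePh_holds

/-! **S2 — LANDED**: `stub_argumentPrinciple : DarbouxPicardConvex ∧ TraceWindingNonneg` is the theorem of
`…DiamondArgumentPrinciple.lean` (p139330; Darboux's theorem for convex targets + no negative winding, from
`Literature.Analysis.Complex.darbouxPicard_convex` / `traceWinding_nonneg`, p138734), imported above. -/

/-- **S3′** `stub_closedPrecompactnessC` (research as an UNCONDITIONAL statement about bond percolation on `ℤ²`; PROVED CONDITIONALLY: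
`closedPrecompactnessC_of_inputs : UniformInnerEnvelope → EdgeCoherence → DiagHalfPlaneOneArmLower → ClosedPrecompactnessC` (DefsR6, p168985) over the
landed p165486 (collar ⇐ 11387's X1), p165722 (guarded class ⇐ route item #2 stmt-11385), p168828 (non-degeneracy ⇐ N ⇐ `IkhlefPonsaingFirstPassage`,
p134439)). Replaces the planner's S3 `ClosedPrecompactness`, whose unguarded class conjunct is too strong as typed. -/
theorem stub_closedPrecompactnessC : ClosedPrecompactnessC := by
  sorry

/-! **S4 — CLOSED.** S4v `stub_boundaryIdentification : BoundaryIdentification` is LANDED (p151443) and with it the engine S4′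
`stub_identifyPotentialPh : ExactPotentialTracePh → (DarbouxPicardConvex ∧ TraceWindingNonneg) → ClosedPrecompactness →
PotentialConformalLimit` (`…DiamondIdentifyPotentialPh.lean`, p153682), imported above and used by name in the composition. -/

/-- **S5** `stub_pinUniformity` (research — the slit uniformity U that crux #5 genuinely owns): from the identified potential
on diamonds (whose derivative along a free side is the phased touch density `c·|Ψ_D′| ds`) to the slit-uniform pinned touch
law on every diagonal-rectilinear polygon: RSW/FKG ratio-stability of the MONOTONE touch laws under pinning by an exploration
prefix and under passing from the diamond to diagonal lattice polygons (non-convex ones included — triage r2-1 (ii), r2-2: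
the convex engine does not reach them; this stub, not S4, carries them). Same research content as iic's S6a
`TouchLawPos → TouchLawPosPin`, rotated by `π/4` and fed by a PROVED identification instead of an idle hypothesis. -/
theorem stub_pinUniformity :
    PotentialConformalLimit → ∀ D : DobrushinDomain, IsDiagRectilinear D → DiagTouchLawPosPin D := by
  sorry

/-- **S6** `stub_identOnDiagRectilinear` (XL; transport, diagonal twin of iic's corrected S6b `S6Corrected`): the pinned touch
law ⇒ every subsequential interface law on a diagonal-rectilinear polygon is chordal SLE₆ — Doob martingales of the pinned
touch functionals (`martingale_touchFunctionalPin`, `condExp_touchCount_ae_eq_touchFunctionalPin`, landed), Kemppainen–Smirnov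
box tightness for the raw (non-simple) medial exploration of bond-`ℤ²` families (`PercFaceBoxTight`-type, RESULT-lead-c4: to be
DESIGNED for non-simple lattice curves), Loewner transport of the window density, the `κ = 6` far-field detector
(`…StubSleSixOfLimitData` clone), Lévy. -/
theorem stub_identOnDiagRectilinear :
    (∀ D : DobrushinDomain, IsDiagRectilinear D → DiagTouchLawPosPin D) → IdentOnDiagRectilinear := by
  sorry

/-- **S7** `stub_allDomainsOfDiagRectilinear` (XL; transport, diagonal twin of iic's S7 `stub_allDomainsOfRectilinear`, whose
reduction `allDomainsOfRectilinear_of` is landed for AXIS polygons): SLE₆ along every admissible family of every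
diagonal-rectilinear polygon ⇒ Cardy for diagonal-rectilinear conformal rectangles (crux 9654's collar-touch-sandwich run at
diagonal designer domains) ⇒ `CardyFormulaZ2` (Bollobás–Riordan sandwich with DIAGONAL lattice-polygon approximants + Radó:
the `π/4`-rotated twin of the PROVED `RectilinearSuffices_proof`) ⇒ Camia–Newman identification on all Jordan domains
(absent for bond-`ℤ²`) ⇒ block C by `slesixAllFamilies_of_identAllFamilies` (landed). -/
theorem stub_allDomainsOfDiagRectilinear :
    (∀ D : DobrushinDomain, IsDiagRectilinear D → ∀ Λ : ℝ → DiscreteDobrushin, IsFamily D Λ → SLESixAlong D Λ) →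
      SLESixAllFamilies := by
  sorry

/-! ## §4 Composition (sorry-free outside the stubs) -/

/-- Identification on diagonal-rectilinear polygons ⇒ SLE₆ along every admissible family of every such polygon: tightness
(Aizenman–Burchard, `isTightAlongMesh_bondInterfaceIn`) and measurability are unconditional (`slesixAlong_of_ident`, landed). -/
theorem slesixAlong_diagRectilinear_of_ident (hI : IdentOnDiagRectilinear) :
    ∀ D : DobrushinDomain, IsDiagRectilinear D → ∀ Λ : ℝ → DiscreteDobrushin, IsFamily D Λ → SLESixAlong D Λ :=
  fun D hD Λ hΛ => slesixAlong_of_ident D Λ hΛ (hI D hD Λ hΛ)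

/-- **Arrow-form composition (r6)** over the STATEMENTS of the four open stubs and the landed S1/S2/S4′ (guarded engine):
`S1 → S2 → S3′ → S4′ → (S5) → (S6) → (S7) → (A → B → C)` (the unfolded crux; A, B are not consumed — `Disproof.lean` §5). -/
theorem slesixAllFamilies_of_stubs (h₁ : ExactPotentialTracePh) (h₂ : DarbouxPicardConvex ∧ TraceWindingNonneg) (h₃ : ClosedPrecompactnessC)
    (h₄ : ExactPotentialTracePh → (DarbouxPicardConvex ∧ TraceWindingNonneg) → ClosedPrecompactnessC → PotentialConformalLimit)
    (h₅ : PotentialConformalLimit → ∀ D : DobrushinDomain, IsDiagRectilinear D → DiagTouchLawPosPin D)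
    (h₆ : (∀ D : DobrushinDomain, IsDiagRectilinear D → DiagTouchLawPosPin D) → IdentOnDiagRectilinear)
    (h₇ : (∀ D : DobrushinDomain, IsDiagRectilinear D → ∀ Λ : ℝ → DiscreteDobrushin, IsFamily D Λ → SLESixAlong D Λ) →
      SLESixAllFamilies) :
    WeakHolFamilies → PrecompactFamilies → SLESixAllFamilies :=
  fun _ _ => h₇ (slesixAlong_diagRectilinear_of_ident (h₆ (h₅ (h₄ h₁ h₂ h₃))))

/-- **The skeleton theorem (r6)**: the four registered stubs and the landed S1 (`exactPotentialTracePh_holds`), S2 (`stub_argumentPrinciple`),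
guarded S4′ (`identifyPotentialPhC`) prove the crux `CardyComplexCone.ParafermionToSLESixFamilies` BY NAME (its `sorryAx` dependence sits entirely
inside the `stub_*` declarations of this file). -/
theorem ParafermionToSLESixFamilies_of : ParafermionToSLESixFamilies :=
  crux_iff.2 (slesixAllFamilies_of_stubs exactPotentialTracePh_holds stub_argumentPrinciple stub_closedPrecompactnessC
    identifyPotentialPhC stub_pinUniformity stub_identOnDiagRectilinear stub_allDomainsOfDiagRectilinear)

/-- **What the crux now reduces to, BY NAME** (kernel-checked; planner-facing): the three named external inputs of S3′, the slit-uniform pinned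
touch law U (S5), the pinned endgame (S6) and the transport (S7). -/
theorem ParafermionToSLESixFamilies_of_inputs
    (hX : Summit.CriticalPhenomena.CardyFormulaZ2.Cruxes.EdgePrecompact.QkzStripBoundaryArm.UniformInnerEnvelope)
    (hE : Summit.CriticalPhenomena.CardyFormulaZ2.Theses.CardyComplexCone.EdgeCoherence)
    (hN : Summit.CriticalPhenomena.CardyFormulaZ2.Cruxes.ParafermionToSLESixFamilies.FlipInvolutionReturnLaw.DiagHalfPlaneOneArmLower)
    (h₅ : PotentialConformalLimit → ∀ D : DobrushinDomain, IsDiagRectilinear D → DiagTouchLawPosPin D)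
    (h₆ : (∀ D : DobrushinDomain, IsDiagRectilinear D → DiagTouchLawPosPin D) → IdentOnDiagRectilinear)
    (h₇ : (∀ D : DobrushinDomain, IsDiagRectilinear D → ∀ Λ : ℝ → DiscreteDobrushin, IsFamily D Λ → SLESixAlong D Λ) →
      SLESixAllFamilies) :
    ParafermionToSLESixFamilies :=
  crux_iff.2 fun _ _ => h₇ (slesixAlong_diagRectilinear_of_ident (h₆ (h₅ (potentialConformalLimit_of_inputs hX hE hN))))

/-! ## §5 Landed reductions visible to the skeleton (sorry-free) -/

/-- S7 is flip's `stub_allDomainsOfDiag` verbatim; its landed reduction `allDomainsOfDiag_of` applies by name: the two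
research inputs are PIECE 1 (SLE₆ on all-diagonal polygons ⇒ Cardy's limit for conformal rectangles with all-diagonal
polygonal boundary) and PIECE 3 (Camia–Newman on `ℤ²`: `CardyFormulaZ2` ⇒ identification on all Jordan domains);
PIECE 2 (the diagonal Bollobás–Riordan sandwich `cardyFormulaZ2_of_diagCardy`) is proved there. -/
theorem stub_allDomainsOfDiagRectilinear_of
    (h1 : (∀ D : DobrushinDomain, IsDiagRectilinear D → ∀ Λ : ℝ → DiscreteDobrushin, IsFamily D Λ → SLESixAlong D Λ) →
      ∀ R : ConformalRectangle, (∃ S : Finset (ℂ × ℂ), (∀ p ∈ S, (p.1 - p.2).re = (p.1 - p.2).im ∨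
        (p.1 - p.2).re = -(p.1 - p.2).im) ∧ frontier R.carrier ⊆ ⋃ p ∈ S, segment ℝ p.1 p.2) →
        R.HasCrossingLimit (bondDomainCrossingProb R) Literature.Probability.RandomPlanarGeometry.cardyFunction)
    (h3 : Literature.Probability.Percolation.CardyFormulaZ2 → ∀ (D : DobrushinDomain) (Λ : ℝ → DiscreteDobrushin),
      IsFamily D Λ → ∀ μ : Measure (CurveClass ℂ), IsProbabilityMeasure μ → IsSubseqLimitLaw (iface D Λ) perc μ →
        IsSLELaw 6 D μ) :
    (∀ D : DobrushinDomain, IsDiagRectilinear D → ∀ Λ : ℝ → DiscreteDobrushin, IsFamily D Λ → SLESixAlong D Λ) →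
      SLESixAllFamilies :=
  allDomainsOfDiag_of h1 h3

end Summit.CriticalPhenomena.CardyFormulaZ2.Cruxes.ParafermionToSLESixFamilies.PotentialDarbouxPicardDiamond

end
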